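import Mathlib
import Literature.AlgebraicGeometry.Resolution.CobordantGame
import Literature.AlgebraicGeometry.Resolution.FormalCoordinateChange
import Summits.ResolutionOfSingularities.ResolutionOfSingularities.Theorems.WeightedInvariantLocalWeightedDropArrangementDoublePoint

/-!
# `WeightedInvariant.LocalWeightedDrop`: the four-plane double points `y² + x₀x₁x₂(a x₀ + b x₁ + c x₂)` are won (characteristic 2)

Crux item stmt-ResolutionOfSingularities-8899 `LocalWeightedDrop`, skeleton v31, residual stub W4|₄ (`d = 2`).  [OURS · L1 W4.3, chain w43, stub
worker 4 (gen 4): the specimen `ArrangementDoublePoint.arrangementDoublePoint_won` transported along the diagonal scalings; NOT a statement of any manuscript.]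

`arrangementDoublePoint_scaled_won`: over an algebraically closed field of characteristic `2`, for all `a, b, c ≠ 0` the germ
`y² + x₀x₁x₂(a x₀ + b x₁ + c x₂)` — the double point over ANY four planes through the origin of `k³` in general position, in adapted
coordinates — is won: with `μ² = abc`, the diagonal change `(x₀,x₁,x₂,y) ↦ (a x₀, b x₁, c x₂, μ y)` carries the specimen
`y² + x₀x₁x₂(x₀+x₁+x₂)` to `abc · (y² + x₀x₁x₂(a x₀ + b x₁ + c x₂))` (`won_subst_iff`, `won_unit_mul_iff`).
-/

set_option linter.dupNamespace false -- mandated namespace of this single-conjunct summit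

namespace Summit.ResolutionOfSingularities.ResolutionOfSingularities.Theorems

open Literature.AlgebraicGeometry.Resolution
open Literature.AlgebraicGeometry.Resolution.CobordantGame

open MvPowerSeries in
/-- **FOUR PLANES IN GENERAL POSITION** (`k` algebraically closed of characteristic `2`, `a b c ≠ 0`):
`y² + x₀x₁x₂(a x₀ + b x₁ + c x₂)` is won — the specimen `ArrangementDoublePoint.arrangementDoublePoint_won` up to the diagonal scaling
`x₀ ↦ a x₀, x₁ ↦ b x₁, x₂ ↦ c x₂, y ↦ √(abc) y`. [OURS · L1 W4.3 · W4|₄ ∩ {d = 2}] -/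
theorem arrangementDoublePoint_scaled_won (k : Type) [Field k] [CharP k 2] [IsAlgClosed k] (a b c : k)
    (ha : a ≠ 0) (hb : b ≠ 0) (hc : c ≠ 0) :
    CobordantGame.Won k 4 (X (Fin.last 3) ^ 2 + rename (Fin.succAboveEmb (Fin.last 3))
      (X 0 * X 1 * X 2 * (C a * X 0 + C b * X 1 + C c * X 2) : MvPowerSeries (Fin 3) k)) := by
  classical
  -- a square root of `abc`
  obtain ⟨μ, hμ⟩ := IsAlgClosed.exists_pow_nat_eq (a * b * c) two_pos
  have hμ0 : μ ≠ 0 := by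
    rintro rfl
    rw [zero_pow two_ne_zero] at hμ
    exact mul_ne_zero (mul_ne_zero ha hb) hc hμ.symm
  -- the diagonal scaling
  set d : Fin 4 → k := Fin.snoc (![a, b, c] : Fin 3 → k) μ with hd
  set φ : Fin 4 → MvPowerSeries (Fin 4) k := fun i => C (d i) * X i with hφ
  have hφ0 : ∀ i, constantCoeff (φ i) = 0 := fun i => by
    rw [hφ]; dsimp only; rw [map_mul, constantCoeff_X, mul_zero]
  have hφdet : IsUnit (FormalCoordChange.linMat φ).det := by
    have hM : FormalCoordChange.linMat φ = Matrix.diagonal d := by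
      ext i j
      rw [FormalCoordChange.linMat, Matrix.of_apply, Matrix.diagonal_apply, hφ]
      dsimp only
      rw [coeff_C_mul, coeff_X]
      by_cases hij : i = j
      · subst hij; rw [if_pos rfl, if_pos rfl, mul_one]
      · rw [if_neg (fun h => hij ((Finsupp.single_left_inj one_ne_zero).mp h).symm), if_neg hij, mul_zero]
    rw [hM, Matrix.det_diagonal, isUnit_iff_ne_zero, Finset.prod_ne_zero_iff]
    intro i _
    rw [hd]
    rcases Fin.eq_castSucc_or_eq_last i with ⟨j, rfl⟩ | rfl
    · rw [Fin.snoc_castSucc]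
      fin_cases j <;> simpa
    · rw [Fin.snoc_last]; exact hμ0
  have hs : HasSubst φ := hasSubst_of_constantCoeff_zero hφ0
  -- the scaling carries the specimen to `abc ·` our germ
  have hd0 : d (Fin.castSucc 0) = a := by rw [hd, Fin.snoc_castSucc]; rfl
  have hd1 : d (Fin.castSucc 1) = b := by rw [hd, Fin.snoc_castSucc]; rfl
  have hd2 : d (Fin.castSucc 2) = c := by rw [hd, Fin.snoc_castSucc]; rfl
  have hd3 : d (Fin.last 3) = μ := by rw [hd, Fin.snoc_last]
  have hspec : subst φ (X (Fin.last 3) ^ 2 + rename (Fin.succAboveEmb (Fin.last 3))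
      (X 0 * X 1 * X 2 * (X 0 + X 1 + X 2) : MvPowerSeries (Fin 3) k)) =
      C (a * b * c) * (X (Fin.last 3) ^ 2 + rename (Fin.succAboveEmb (Fin.last 3))
        (X 0 * X 1 * X 2 * (C a * X 0 + C b * X 1 + C c * X 2) : MvPowerSeries (Fin 3) k)) := by
    have hφapp : ∀ j, φ j = C (d j) * X j := fun _ => rfl
    have hCμ : (C μ : MvPowerSeries (Fin 4) k) ^ 2 = C a * C b * C c := by rw [← map_pow, hμ, map_mul, map_mul]
    rw [← coe_substAlgHom hs]
    simp only [map_add, map_pow, map_mul, coe_substAlgHom, subst_X hs, rename_X, rename_C, Fin.coe_succAboveEmb,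
      Fin.succAbove_last, hφapp, hd0, hd1, hd2, hd3]
    linear_combination (X (Fin.last 3) : MvPowerSeries (Fin 4) k) ^ 2 * hCμ
  have hW := ArrangementDoublePoint.arrangementDoublePoint_won k
  rw [← won_subst_iff hφ0 hφdet, hspec, won_unit_mul_iff (by
    rw [constantCoeff_C]; exact mul_ne_zero (mul_ne_zero ha hb) hc)] at hW
  exact hW

end Summit.ResolutionOfSingularities.ResolutionOfSingularities.Theorems
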